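import Mathlib
import HarnessLib

/-!
# First-order expansion of `Im F` off a segment where `F` is real; the Poisson kernel at a flat boundary point

Topic `Literature/Analysis/Complex`. Elementary local analysis at a point `x` of a straight
segment `{x + ντ : |τ| < ρ}` (`|ν| = 1`) on which a holomorphic function is real — the situation
of a conformal map `w : D → ℍ` at a flat boundary point of `D` (by Schwarz reflection `w` is
holomorphic across the segment; in the tree's fact
`Literature.Probability.LatticeModels.ChelkakSmirnov2011_boundaryNormalisedPoissonKernelLimit`
holomorphy on a neighbourhood of `x` is a hypothesis). This is the continuum input of the
normalisation step in D. Chelkak, S. Smirnov, Adv. Math. 228 (2011), proof of Thm. 3.13: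
"`P(x + iy) = y·P′… + O(…)`", i.e. the Poisson kernel is `t·∂_νP(x) + O(|τ|t + t²)` at the point
`x + ν(τ + it)`.

* `hasDerivAt_im_comp_normal` — `d/ds Im F(x + ν(τ + is)) = Re(ν F′)`;
* **`abs_im_sub_mul_le`** — if `F` is analytic at `x` and `Im F = 0` on the segment, then
  `|Im F(x + ν(τ + it)) - t·Re(ν F′(x))| ≤ C(|τ|t + t²)` for `|τ|, t ≤ ρ₁` (`t ≥ 0`);
* `im_mul_deriv_eq_zero` — `w` real on the segment ⇒ `Im(ν w′(x)) = 0`;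
  `re_mul_deriv_nonneg` — `Im w > 0 = Im w(x)` on the inner normal ⇒ `Re(ν w′(x)) ≥ 0`;
  `mul_deriv_eq_norm` — hence `ν w′(x) = |w′(x)|` when `w′(x) ≠ 0`;
* **`abs_poisson_sub_mul_le`** — for `w` analytic at `x`, real on the segment, with `Im w > 0`
  on the inner normal, and a real `c ≠ w x`:
  `|Im w(p)/|w(p) - c|² - t·|w′(x)|/|w(x) - c|²| ≤ C(|τ|t + t²)`, `p = x + ν(τ + it)` — the
  expansion of the `ℍ`-Poisson kernel `Im(-1/(w - c)) = Im w/|w - c|²` pulled back by `w`.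

Everything is proved, [folklore].
-/

noncomputable section

namespace Literature.Analysis.Complex

open _root_.Complex Metric Set Filter
open scoped Topology Real

/-! ### Derivatives along the normal and the tangent -/

/-- The normal path `s ↦ x + ν(τ + is)` has velocity `νi`. [folklore] -/
theorem hasDerivAt_normalPath (x ν : ℂ) (τ s : ℝ) :
    HasDerivAt (fun s : ℝ => x + ν * ((τ : ℂ) + (s : ℂ) * I)) (ν * I) s := by
  have h1 : HasDerivAt (fun s : ℝ => (s : ℂ)) 1 s := (hasDerivAt_id (s : ℂ)).comp_ofReal
  have h2 := ((h1.mul_const I).const_add (τ : ℂ)).const_mul ν |>.const_add x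
  simpa using h2

/-- The tangent path `τ ↦ x + ντ` has velocity `ν`. [folklore] -/
theorem hasDerivAt_tangentPath (x ν : ℂ) (τ : ℝ) :
    HasDerivAt (fun τ : ℝ => x + ν * (τ : ℂ)) ν τ := by
  have h1 : HasDerivAt (fun τ : ℝ => (τ : ℂ)) 1 τ := (hasDerivAt_id (τ : ℂ)).comp_ofReal
  simpa using (h1.const_mul ν).const_add x

/-- Imaginary part of a path derivative. [folklore] -/
theorem hasDerivAt_im_comp {e : ℝ → ℂ} {e' : ℂ} {s : ℝ} (h : HasDerivAt e e' s) :
    HasDerivAt (fun s => (e s).im) e'.im s := by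
  rw [hasDerivAt_iff_tendsto_slope_zero] at h ⊢
  have hc : Tendsto (fun t : ℝ => (t⁻¹ • (e (s + t) - e s)).im) (𝓝[≠] 0) (𝓝 e'.im) :=
    (continuous_im.tendsto _).comp h
  refine hc.congr fun t => ?_
  simp only [smul_eq_mul, sub_im, Complex.real_smul, mul_im, ofReal_re, ofReal_im, zero_mul,
    add_zero]

/-- **`d/ds Im F(x + ν(τ + is)) = Re(ν F′(x + ν(τ + is)))`.** [folklore] -/
theorem hasDerivAt_im_comp_normal {F : ℂ → ℂ} {F' : ℂ} {x ν : ℂ} {τ s : ℝ}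
    (hF : HasDerivAt F F' (x + ν * ((τ : ℂ) + (s : ℂ) * I))) :
    HasDerivAt (fun s : ℝ => (F (x + ν * ((τ : ℂ) + (s : ℂ) * I))).im) (ν * F').re s := by
  have h1 := hF.comp s (hasDerivAt_normalPath x ν τ s)
  have h2 := hasDerivAt_im_comp h1
  have h3 : (F' * (ν * I)).im = (ν * F').re := by
    simp only [mul_im, mul_re, I_re, I_im, mul_zero, mul_one, add_zero]; ring
  rw [h3] at h2
  exact h2

/-! ### The expansion of `Im F` off the segment -/

/-- **First-order expansion off a segment of reality.** Let `F` be analytic at `x`, `|ν| = 1`, and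
`Im F(x + ντ) = 0` for real `|τ| < ρ`. Then there are `C` and `ρ₁ > 0` such that
`|Im F(x + ν(τ + it)) - t Re(ν F′(x))| ≤ C(|τ| t + t²)` for `|τ| ≤ ρ₁`, `0 ≤ t ≤ ρ₁`.
(Fundamental theorem of calculus along the normal, Lipschitz continuity of `F′`.) [folklore] -/
theorem abs_im_sub_mul_le {F : ℂ → ℂ} {x ν : ℂ} (hF : AnalyticAt ℂ F x) (hν : ‖ν‖ = 1) {ρ : ℝ}
    (hρ : 0 < ρ) (hflat : ∀ τ : ℝ, |τ| < ρ → (F (x + ν * (τ : ℂ))).im = 0) :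
    ∃ C ρ₁ : ℝ, 0 ≤ C ∧ 0 < ρ₁ ∧ ∀ τ t : ℝ, |τ| ≤ ρ₁ → 0 ≤ t → t ≤ ρ₁ →
      |(F (x + ν * ((τ : ℂ) + (t : ℂ) * I))).im - t * (ν * deriv F x).re| ≤ C * (|τ| * t + t ^ 2) := by
  -- `F` is differentiable on a ball, `F′` is Lipschitz on a ball
  obtain ⟨r₀, hr₀, hFan⟩ := hF.exists_ball_analyticOnNhd
  have hF'c : ContDiffAt ℂ 1 (deriv F) x := hF.deriv.contDiffAt
  obtain ⟨K, T, hT, hLip⟩ := hF'c.exists_lipschitzOnWith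
  obtain ⟨r₁, hr₁, hr₁T⟩ := Metric.mem_nhds_iff.1 hT
  set ρ₁ := min (min r₀ r₁) ρ / 4 with hρ₁
  have hρ₁0 : 0 < ρ₁ := by rw [hρ₁]; positivity
  have hρ₁r₀ : 4 * ρ₁ ≤ r₀ := by
    rw [hρ₁]; linarith [min_le_left (min r₀ r₁) ρ, min_le_left r₀ r₁]
  have hρ₁r₁ : 4 * ρ₁ ≤ r₁ := by
    rw [hρ₁]; linarith [min_le_left (min r₀ r₁) ρ, min_le_right r₀ r₁]
  have hρ₁ρ : 4 * ρ₁ ≤ ρ := by rw [hρ₁]; linarith [min_le_right (min r₀ r₁) ρ]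
  refine ⟨K, ρ₁, K.2, hρ₁0, fun τ t hτ ht0 ht => ?_⟩
  -- points of the normal segment are close to `x`
  have hclose : ∀ s : ℝ, 0 ≤ s → s ≤ t →
      ‖x + ν * ((τ : ℂ) + (s : ℂ) * I) - x‖ ≤ |τ| + s := by
    intro s hs0 hst
    rw [add_sub_cancel_left, norm_mul, hν, one_mul]
    calc ‖(τ : ℂ) + (s : ℂ) * I‖ ≤ ‖(τ : ℂ)‖ + ‖(s : ℂ) * I‖ := norm_add_le _ _
      _ = |τ| + s := by
          rw [norm_real, norm_mul, norm_real, norm_I, mul_one, Real.norm_eq_abs,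
            Real.norm_eq_abs, abs_of_nonneg hs0]
  have hmem_ball : ∀ s : ℝ, 0 ≤ s → s ≤ t → x + ν * ((τ : ℂ) + (s : ℂ) * I) ∈ ball x r₀ := by
    intro s hs0 hst
    rw [mem_ball, dist_eq_norm]
    linarith [hclose s hs0 hst]
  have hmem_T : ∀ s : ℝ, 0 ≤ s → s ≤ t → x + ν * ((τ : ℂ) + (s : ℂ) * I) ∈ T := by
    intro s hs0 hst
    apply hr₁T
    rw [mem_ball, dist_eq_norm]
    linarith [hclose s hs0 hst]
  -- the comparison function `ψ s = Im F(p s) - s A`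
  set A := (ν * deriv F x).re with hA
  set ψ : ℝ → ℝ := fun s => (F (x + ν * ((τ : ℂ) + (s : ℂ) * I))).im - s * A with hψ
  have hψ0 : ψ 0 = 0 := by
    simp only [hψ, ofReal_zero, zero_mul, add_zero, sub_zero]
    exact hflat τ (by linarith)
  have hderiv : ∀ s ∈ Icc (0 : ℝ) t,
      HasDerivWithinAt ψ ((ν * deriv F (x + ν * ((τ : ℂ) + (s : ℂ) * I))).re - A) (Icc 0 t) s := by
    intro s hs
    have hd : HasDerivAt F (deriv F (x + ν * ((τ : ℂ) + (s : ℂ) * I)))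
        (x + ν * ((τ : ℂ) + (s : ℂ) * I)) :=
      ((hFan _ (hmem_ball s hs.1 hs.2)).differentiableAt).hasDerivAt
    have h1 := hasDerivAt_im_comp_normal hd
    have h2 : HasDerivAt (fun s : ℝ => s * A) A s := by simpa using (hasDerivAt_id s).mul_const A
    exact (h1.sub h2).hasDerivWithinAt
  have hbound : ∀ s ∈ Ico (0 : ℝ) t,
      ‖(ν * deriv F (x + ν * ((τ : ℂ) + (s : ℂ) * I))).re - A‖ ≤ K * (|τ| + t) := by
    intro s hs
    rw [hA, ← sub_re, ← mul_sub, Real.norm_eq_abs]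
    calc |(ν * (deriv F (x + ν * ((τ : ℂ) + (s : ℂ) * I)) - deriv F x)).re|
        ≤ ‖ν * (deriv F (x + ν * ((τ : ℂ) + (s : ℂ) * I)) - deriv F x)‖ := abs_re_le_norm _
      _ = ‖deriv F (x + ν * ((τ : ℂ) + (s : ℂ) * I)) - deriv F x‖ := by rw [norm_mul, hν, one_mul]
      _ ≤ K * ‖x + ν * ((τ : ℂ) + (s : ℂ) * I) - x‖ := by
          rw [← dist_eq_norm, ← dist_eq_norm]
          exact hLip.dist_le_mul _ (hmem_T s hs.1 hs.2.le) _ (hr₁T (mem_ball_self hr₁))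
      _ ≤ K * (|τ| + s) := mul_le_mul_of_nonneg_left (hclose s hs.1 hs.2.le) K.2
      _ ≤ K * (|τ| + t) := mul_le_mul_of_nonneg_left (by linarith [hs.2]) K.2
  have hmvt := norm_image_sub_le_of_norm_deriv_le_segment' hderiv hbound t
    ⟨ht0, le_rfl⟩
  rw [hψ0, sub_zero, Real.norm_eq_abs] at hmvt
  simp only [hψ] at hmvt
  calc |(F (x + ν * ((τ : ℂ) + (t : ℂ) * I))).im - t * A|
      ≤ K * (|τ| + t) * (t - 0) := hmvt
    _ = K * (|τ| * t + t ^ 2) := by ring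

/-! ### The derivative of a map real on the segment and positive inside -/

/-- **`w` real on the segment ⇒ `Im(ν w′(x)) = 0`.** [folklore] -/
theorem im_mul_deriv_eq_zero {w : ℂ → ℂ} {x ν : ℂ} (hw : DifferentiableAt ℂ w x) {ρ : ℝ}
    (hρ : 0 < ρ) (hflat : ∀ τ : ℝ, |τ| < ρ → (w (x + ν * (τ : ℂ))).im = 0) :
    (ν * deriv w x).im = 0 := by
  have h1 : HasDerivAt (fun τ : ℝ => (w (x + ν * (τ : ℂ))).im) (deriv w x * ν).im 0 := by
    have hd : HasDerivAt w (deriv w x) (x + ν * ((0 : ℝ) : ℂ)) := by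
      simpa using hw.hasDerivAt
    exact hasDerivAt_im_comp (hd.comp (0 : ℝ) (hasDerivAt_tangentPath x ν 0))
  have h2 : HasDerivAt (fun τ : ℝ => (w (x + ν * (τ : ℂ))).im) 0 0 := by
    refine (hasDerivAt_const (0 : ℝ) (0 : ℝ)).congr_of_eventuallyEq ?_
    filter_upwards [Metric.ball_mem_nhds (0 : ℝ) hρ] with τ hτ
    rw [mem_ball, Real.dist_eq, sub_zero] at hτ
    exact hflat τ hτ
  have := h1.unique h2
  rwa [mul_comm] at this

/-- **`Im w > Im w(x) = 0` on the inner normal ⇒ `Re(ν w′(x)) ≥ 0`.** [folklore] -/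
theorem re_mul_deriv_nonneg {w : ℂ → ℂ} {x ν : ℂ} (hw : DifferentiableAt ℂ w x)
    (hx : (w x).im = 0) {ρ : ℝ} (hρ : 0 < ρ)
    (hpos : ∀ t : ℝ, 0 < t → t < ρ → 0 < (w (x + ν * ((t : ℂ) * I))).im) :
    0 ≤ (ν * deriv w x).re := by
  set f : ℝ → ℝ := fun t => (w (x + ν * (((0 : ℝ) : ℂ) + (t : ℂ) * I))).im with hf
  have hd : HasDerivAt w (deriv w x) (x + ν * (((0 : ℝ) : ℂ) + ((0 : ℝ) : ℂ) * I)) := by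
    simpa using hw.hasDerivAt
  have h1 : HasDerivAt f (ν * deriv w x).re 0 := hasDerivAt_im_comp_normal hd
  have hf0 : f 0 = 0 := by simp [hf, hx]
  have hslope := h1.tendsto_slope_zero_right
  refine ge_of_tendsto hslope ?_
  filter_upwards [Ioo_mem_nhdsGT hρ] with t ht
  rw [zero_add, hf0, sub_zero, smul_eq_mul]
  have : 0 < f t := by
    simp only [hf, ofReal_zero, zero_add]
    exact hpos t ht.1 ht.2
  exact mul_nonneg (inv_nonneg.2 ht.1.le) this.le

/-- `ν a = |a|` when `Im(ν a) = 0`, `Re(ν a) ≥ 0` and `|ν| = 1`. [folklore] -/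
theorem mul_eq_norm_of_im_eq_zero {ν a : ℂ} (hν : ‖ν‖ = 1) (him : (ν * a).im = 0)
    (hre : 0 ≤ (ν * a).re) : ν * a = (‖a‖ : ℂ) := by
  have h1 : ν * a = (((ν * a).re : ℝ) : ℂ) := by
    apply Complex.ext <;> simp [him]
  have h2 : ‖ν * a‖ = (ν * a).re := by
    nth_rewrite 1 [h1]
    rw [norm_real, Real.norm_eq_abs, abs_of_nonneg hre]
  rw [norm_mul, hν, one_mul] at h2
  rw [h1, h2]

/-! ### The Poisson kernel of `ℍ` pulled back by `w` -/

/-- `Im(-(z)⁻¹) = Im z/|z|²`. [folklore] -/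
theorem neg_inv_im (z : ℂ) : (-z⁻¹).im = z.im / ‖z‖ ^ 2 := by
  rw [neg_im, inv_im, neg_div, neg_neg, Complex.sq_norm]

/-- **The `ℍ`-Poisson kernel through `w` at a flat boundary point.** Let `w` be analytic at `x`,
`|ν| = 1`, `w` real on the segment `{x + ντ : |τ| < ρ}` and `Im w > 0` on the inner normal
`{x + iνt : 0 < t < ρ}`, and `c ∈ ℝ` with `w x ≠ c`. Then for some `C` and
`ρ₁ > 0`, for `|τ| ≤ ρ₁` and `0 ≤ t ≤ ρ₁`,
`|Im w(p)/|w(p) - c|² - t·|w′(x)|/|w(x) - c|²| ≤ C(|τ|t + t²)`, `p = x + ν(τ + it)`.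
[folklore] -/
theorem abs_poisson_sub_mul_le {w : ℂ → ℂ} {x ν : ℂ} (hw : AnalyticAt ℂ w x) (hν : ‖ν‖ = 1)
    {ρ : ℝ} (hρ : 0 < ρ) (hflat : ∀ τ : ℝ, |τ| < ρ → (w (x + ν * (τ : ℂ))).im = 0)
    (hpos : ∀ t : ℝ, 0 < t → t < ρ → 0 < (w (x + ν * ((t : ℂ) * I))).im)
    {c : ℝ} (hc : w x ≠ c) :
    ∃ C ρ₁ : ℝ, 0 ≤ C ∧ 0 < ρ₁ ∧ ∀ τ t : ℝ, |τ| ≤ ρ₁ → 0 ≤ t → t ≤ ρ₁ →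
      |(w (x + ν * ((τ : ℂ) + (t : ℂ) * I))).im / ‖w (x + ν * ((τ : ℂ) + (t : ℂ) * I)) - c‖ ^ 2 -
        t * (‖deriv w x‖ / ‖w x - c‖ ^ 2)| ≤ C * (|τ| * t + t ^ 2) := by
  -- `F = -(w - c)⁻¹`
  set F : ℂ → ℂ := fun u => -(w u - c)⁻¹ with hF
  have hwc : w x - c ≠ 0 := sub_ne_zero.2 hc
  have hFa : AnalyticAt ℂ F x := ((hw.sub analyticAt_const).inv hwc).neg
  have hFim : ∀ u, (F u).im = (w u).im / ‖w u - c‖ ^ 2 := by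
    intro u; simp only [hF, neg_inv_im, sub_im, ofReal_im, sub_zero]
  have hFflat : ∀ τ : ℝ, |τ| < ρ → (F (x + ν * (τ : ℂ))).im = 0 := by
    intro τ hτ; rw [hFim, hflat τ hτ, zero_div]
  obtain ⟨C, ρ₁, hC, hρ₁, hest⟩ := abs_im_sub_mul_le hFa hν hρ hFflat
  -- the derivative of `F` at `x`
  have hx0 : (w x).im = 0 := by simpa using hflat 0 (by simpa using hρ)
  have hνw : ν * deriv w x = (‖deriv w x‖ : ℂ) :=
    mul_eq_norm_of_im_eq_zero hν (im_mul_deriv_eq_zero hw.differentiableAt hρ hflat)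
      (re_mul_deriv_nonneg hw.differentiableAt hx0 hρ hpos)
  have hFd : deriv F x = deriv w x / (w x - c) ^ 2 := by
    have h1 : HasDerivAt (fun u => w u - c) (deriv w x) x :=
      hw.differentiableAt.hasDerivAt.sub_const _
    have h2 := (h1.inv hwc).neg
    have h3 : HasDerivAt F (-(-deriv w x / (w x - c) ^ 2)) x :=
      h2.congr_of_eventuallyEq (Eventually.of_forall fun u => by simp [hF])
    rw [h3.deriv]; ring
  have hwx : w x - c = ((((w x).re - c : ℝ)) : ℂ) := by
    apply Complex.ext <;> simp [hx0]
  have hA : (ν * deriv F x).re = ‖deriv w x‖ / ‖w x - c‖ ^ 2 := by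
    rw [hFd, mul_div_assoc', hνw, hwx, norm_real, Real.norm_eq_abs, sq_abs, ← ofReal_pow,
      ← ofReal_div, ofReal_re]
  refine ⟨C, ρ₁, hC, hρ₁, fun τ t hτ ht0 ht => ?_⟩
  have := hest τ t hτ ht0 ht
  rwa [hFim, hA] at this

end Literature.Analysis.Complex
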